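import Mathlib.Analysis.Complex.Basic
import Mathlib.Analysis.Real.Sqrt
import Mathlib.Algebra.Order.Round
import Literature.Probability.LatticeModels.DelaunayGraph
import HarnessLib

/-!
# Delaunay pairs of the disc-jittered square lattice are king moves — stub `stub_jsdKing`
# of line `SketchIdeator5R2` for crux `SquareFromVoronoiHub` (stmt-CriticalPhenomena-6434)

For jitter amplitude `a < (1 - 1/√2)/2` the point set `S = {u.1 + u.2 I + ξ u}` (`‖ξ u‖ ≤ a`) has
covering radius `≤ 1/√2 + a < 1 - a`, while two jittered sites whose lattice labels differ by `≥ 2`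
in some coordinate are `≥ 2 - 2a` apart; an empty circumscribed ball through both would have radius
`≥ 1 - a`, and rounding its centre to `ℤ²` produces a site strictly inside it.  Elementary.
-/

noncomputable section

open Literature.Probability.LatticeModels (IsDelaunayPair)

namespace Summit.CriticalPhenomena.CardyFormulaZ2.Cruxes.SquareFromVoronoiHub.ProductLeg

namespace stub_jsdKingAux

/-- Two lattice points whose labels are not a king move apart are at Euclidean distance `≥ 2`:
one coordinate differs by an integer `≥ 2`, and the norm of a complex number dominates the absolute
values of its real and imaginary parts. [folklore] -/
theorem two_le_norm_sub_of_not_king (v w : ℤ × ℤ) (h : ¬(|v.1 - w.1| ≤ 1 ∧ |v.2 - w.2| ≤ 1)) :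
    (2 : ℝ) ≤ ‖((v.1 : ℂ) + (v.2 : ℂ) * Complex.I) - ((w.1 : ℂ) + (w.2 : ℂ) * Complex.I)‖ := by
  set d : ℂ := ((v.1 : ℂ) + (v.2 : ℂ) * Complex.I) - ((w.1 : ℂ) + (w.2 : ℂ) * Complex.I) with hd
  have hre : d.re = ((v.1 - w.1 : ℤ) : ℝ) := by simp [hd]
  have him : d.im = ((v.2 - w.2 : ℤ) : ℝ) := by simp [hd]
  rw [not_and_or, not_le, not_le] at h
  rcases h with h | h
  · have h2 : (2 : ℤ) ≤ |v.1 - w.1| := by omega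
    calc (2 : ℝ) ≤ |d.re| := by rw [hre, ← Int.cast_abs]; exact_mod_cast h2
      _ ≤ ‖d‖ := Complex.abs_re_le_norm d
  · have h2 : (2 : ℤ) ≤ |v.2 - w.2| := by omega
    calc (2 : ℝ) ≤ |d.im| := by rw [him, ← Int.cast_abs]; exact_mod_cast h2
      _ ≤ ‖d‖ := Complex.abs_im_le_norm d

/-- Covering radius of `ℤ²`: rounding the coordinates of `c` gives a lattice point at squared
distance `≤ 1/4 + 1/4 = 1/2` (`|x - round x| ≤ 1/2`). [folklore] -/
theorem norm_round_sub_sq_le (c : ℂ) :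
    ‖(((round c.re : ℤ) : ℂ) + ((round c.im : ℤ) : ℂ) * Complex.I) - c‖ ^ 2 ≤ 1 / 2 := by
  rw [Complex.sq_norm, Complex.normSq_apply]
  have h1 := abs_sub_round c.re
  have h2 := abs_sub_round c.im
  have e1 : ((((round c.re : ℤ) : ℂ) + ((round c.im : ℤ) : ℂ) * Complex.I) - c).re
      = ((round c.re : ℤ) : ℝ) - c.re := by simp
  have e2 : ((((round c.re : ℤ) : ℂ) + ((round c.im : ℤ) : ℂ) * Complex.I) - c).im
      = ((round c.im : ℤ) : ℝ) - c.im := by simp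
  rw [e1, e2]
  rw [abs_le] at h1 h2
  nlinarith [h1.1, h1.2, h2.1, h2.2]

/-- The numerical punchline: `1 - a ≤ t + a` with `t² ≤ 1/2` is impossible once
`a < (1 - 1/√2)/2`, i.e. `1/√2 < 1 - 2a`. [folklore] -/
theorem absurd_of_radius (a t : ℝ) (ha : a < (1 - 1 / Real.sqrt 2) / 2)
    (ht2 : t ^ 2 ≤ 1 / 2) (h : 1 - a ≤ t + a) : False := by
  set s : ℝ := Real.sqrt 2 with hs_def
  have hs2 : s * s = 2 := Real.mul_self_sqrt (by norm_num)
  have hspos : 0 < s := by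
    have : (0 : ℝ) < 2 := by norm_num
    rw [hs_def]; exact Real.sqrt_pos.mpr this
  have hinv : 1 / s = s / 2 := by
    rw [div_eq_div_iff hspos.ne' two_ne_zero]; linarith
  rw [hinv] at ha
  -- `s / 2 < 1 - 2a ≤ t`, hence `1/2 = (s/2)² < t²`.
  have hlt : s / 2 < t := by linarith
  have hpos1 : 0 < t - s / 2 := by linarith
  have hpos2 : 0 < t + s / 2 := by linarith
  nlinarith [mul_pos hpos1 hpos2]

end stub_jsdKingAux

open stub_jsdKingAux in
/-- **Stub (ii) of the endpoint geometry** (`JitteredSquareDelaunay`): for jitter amplitude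
`a < (1 - 1/√2)/2`, every Delaunay pair (closed empty-ball rule) of the jittered square lattice
`S = {u.1 + u.2 I + ξ u | u ∈ ℤ²}`, `‖ξ u‖ ≤ a`, is a king move: `|v.1 - w.1| ≤ 1` and
`|v.2 - w.2| ≤ 1`.  Proof: otherwise the two sites are `≥ 2 - 2a` apart, so the empty ball has
radius `r ≥ 1 - a`; rounding its centre to `ℤ²` gives a site of `S` at distance `≤ 1/√2 + a < 1 - a`
from the centre, inside the empty ball. [folklore] -/
theorem stub_jsdKing :
    ∀ (a : ℝ) (ξ : ℤ × ℤ → ℂ), 0 ≤ a → a < (1 - 1 / Real.sqrt 2) / 2 → (∀ v, ‖ξ v‖ ≤ a) →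
      ∀ v w : ℤ × ℤ, v ≠ w →
        IsDelaunayPair (Set.range fun u : ℤ × ℤ => ((u.1 : ℂ) + (u.2 : ℂ) * Complex.I) + ξ u)
          (((v.1 : ℂ) + (v.2 : ℂ) * Complex.I) + ξ v) (((w.1 : ℂ) + (w.2 : ℂ) * Complex.I) + ξ w) →
        |v.1 - w.1| ≤ 1 ∧ |v.2 - w.2| ≤ 1 := by
  intro a ξ _ha0 ha hξ v w _hvw hD
  obtain ⟨c, r, hv, hw, hempty⟩ := hD
  by_contra hcon
  -- The two lattice labels are `≥ 2` apart, so the jittered sites are `≥ 2 - 2a` apart.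
  have hfar := two_le_norm_sub_of_not_king v w hcon
  set zv : ℂ := (v.1 : ℂ) + (v.2 : ℂ) * Complex.I with hzv
  set zw : ℂ := (w.1 : ℂ) + (w.2 : ℂ) * Complex.I with hzw
  have hle : ‖zv - zw‖ ≤ dist (zv + ξ v) (zw + ξ w) + a + a := by
    have e : zv - zw = ((zv + ξ v) - (zw + ξ w)) - (ξ v - ξ w) := by ring
    calc ‖zv - zw‖ = ‖((zv + ξ v) - (zw + ξ w)) - (ξ v - ξ w)‖ := by rw [← e]
      _ ≤ ‖(zv + ξ v) - (zw + ξ w)‖ + ‖ξ v - ξ w‖ := norm_sub_le _ _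
      _ ≤ ‖(zv + ξ v) - (zw + ξ w)‖ + (‖ξ v‖ + ‖ξ w‖) := by
        gcongr; exact norm_sub_le _ _
      _ ≤ dist (zv + ξ v) (zw + ξ w) + a + a := by
        rw [dist_eq_norm]; linarith [hξ v, hξ w]
  -- The radius of the empty ball is `≥ 1 - a`.
  have htri : dist (zv + ξ v) (zw + ξ w) ≤ r + r := by
    calc dist (zv + ξ v) (zw + ξ w) ≤ dist (zv + ξ v) c + dist (zw + ξ w) c :=
          dist_triangle_right _ _ _
      _ = r + r := by rw [hv, hw]
  have hr : 1 - a ≤ r := by linarith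
  -- Round the centre to the lattice: the corresponding site lies within `1/√2 + a` of `c`.
  set u : ℤ × ℤ := (round c.re, round c.im) with hu
  set zu : ℂ := (u.1 : ℂ) + (u.2 : ℂ) * Complex.I with hzu
  have hmem : zu + ξ u ∈ Set.range (fun u : ℤ × ℤ => ((u.1 : ℂ) + (u.2 : ℂ) * Complex.I) + ξ u) :=
    ⟨u, rfl⟩
  have hru : r ≤ dist (zu + ξ u) c := hempty _ hmem
  have hdist : dist (zu + ξ u) c ≤ ‖zu - c‖ + a := by
    rw [dist_eq_norm]
    calc ‖zu + ξ u - c‖ = ‖(zu - c) + ξ u‖ := by congr 1; ring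
      _ ≤ ‖zu - c‖ + ‖ξ u‖ := norm_add_le _ _
      _ ≤ ‖zu - c‖ + a := by linarith [hξ u]
  have ht2 : ‖zu - c‖ ^ 2 ≤ 1 / 2 := by
    have := norm_round_sub_sq_le c
    simpa [hzu, hu] using this
  exact absurd_of_radius a ‖zu - c‖ ha ht2 (by linarith)

end Summit.CriticalPhenomena.CardyFormulaZ2.Cruxes.SquareFromVoronoiHub.ProductLeg

end
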